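import Mathlib.MeasureTheory.Integral.CircleIntegral
import Literature.Probability.RandomPlanarGeometry.USTPeanoPath
import Literature.Probability.RandomPlanarGeometry.SLETraceApproximation
import Literature.Probability.RandomPlanarGeometry.CaratheodoryHalfPlaneProofs
import HarnessLib

/-!
# [LSW04] §4.2–4.3: the setting of the UST Peano curve scaling limit

G. F. Lawler, O. Schramm, W. Werner, *Conformal invariance of planar loop-erased random walks and
uniform spanning trees*, Ann. Probab. **32** (2004) 939–995 (**[LSW04]**). On top of the
combinatorial UST Peano path (`USTPeanoPath.lean`) this file formalises the objects in which
Thm. 4.4, Prop. 4.5 and Thms. 4.7–4.8 are stated (the facts themselves are in `LSW2004UST.lean`):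

* `USTPeano.Domain.IsLSWMap Δ φ` — "`φ : D → ℍ` the conformal map which takes `a` to `0`, `b` to
  `∞` and satisfies `|φ(0)| = 1`" (§4.2, p. 973; Thm. 4.4), for the tree's `ConformalEquiv`
  `φ : ℍ → D` (so LSW's map is `φ.symm`): chordal uniformizing (`IsChordalUniformizing`: boundary
  value `a` at `0`, `b` at `∞`) and `‖φ.symm 0‖ = 1`; it exists when `0 ∈ D`
  (`Domain.exists_isLSWMap`, from the PROVED `MarkedDomain.exists_isChordalUniformizing_holds`).
* `USTPeano.IsCapacityImage Δ φ γ γ̂ W` — "`γ̂ := φ ∘ γ`, parameterized according to capacity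
  from `∞`, and `W(t)` the Loewner driving process for `γ̂`" (Thm. 4.4): `γ̂ : C([0,∞), ℂ)` is an
  increasing reparametrisation onto `[0, ∞)` of `φ⁻¹ ∘ γ` on the open time interval of the Peano
  path, `γ̂(0) = 0`, and the chordal Loewner chain driven by the continuous `W` is generated by
  `γ̂` (`Loewner.IsGeneratedByCurve`, which pins down the half-plane-capacity parametrisation and
  the driving function).
* `USTPeano.SmoothDomain` — §4.3, p. 977: a Jordan domain `D ∋ 0` with two marked boundary points
  `a ≠ b` whose boundary loop is `C¹`, regular and positively oriented; `SmoothDomain.unitDisc`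
  (with `a = 1`, `b = -1`) shows the notion is inhabited; the arcs `arcA` (`α_D`, clockwise from
  `b` to `a`, here run from `a` to `b`) and `arcB` (`β_D`);
* `USTPeano.IsApproximation D R Δ` — the grid approximations `D^R = D(α^R, β^R, a^R, b^R) ∈ 𝔇*`
  of `(RD, Rα_D, Rβ_D)`: `ρ(α^R, Rα_D) ≤ C`, `ρ(β^R, Rβ_D) ≤ C` with `ρ` the reparametrisation
  distance of paths (§3.4; the tree's `Curve.reparamDist`) and `C = 10` ("for example, `C = 10`
  would do"); we add `0 ∈ D^R` (used by LSW to normalise `φ_R`);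
* `USTPeano.brownianTimeEight` — the path `t ↦ B(8t)` of the canonical Brownian motion, the limit
  object of Thm. 4.4 / p. 981, a random element of `C([0,∞), ℝ)`.
-/

noncomputable section

open Set Function Filter MeasureTheory Complex Real
open _root_.Topology
open UpperHalfPlane (upperHalfPlaneSet)
open scoped NNReal ENNReal unitInterval

namespace Literature.Probability.RandomPlanarGeometry

open scoped PathBorel

namespace USTPeano

/-! ### §4.2: the normalised conformal map and the capacity parametrisation -/

namespace Domain

variable (Δ : Domain)

/-- **LSW's normalised conformal map** of `D = D(α, β, a, b) ∋ 0` ([LSW04] §4.2, p. 973: "Let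
`φ₀ = φ : D → ℍ` be the conformal map which takes `D` to `ℍ`, takes `b` to `∞`, takes `a` to `0`
and satisfies `|φ(0)| = 1`"; likewise in Thm. 4.4 and §4.3), expressed for the tree's conformal
equivalences `φ : ℍ → D` (LSW's map is `φ.symm : D → ℍ`): `φ` is a chordal uniformizing map of
the Dobrushin domain `(D; a, b)` — boundary value `a` at `0` and `b` at `∞`; since `D` is a Jordan
domain the boundary extension is a homeomorphism of the closures (Carathéodory, proved in the
tree), so this is the same as "`φ⁻¹(z) → 0` as `z → a`, `φ⁻¹(z) → ∞` as `z → b`" — and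
`|φ⁻¹(0)| = 1`. [cite: LawlerSchrammWerner2004, §4.2] -/
def IsLSWMap (φ : ConformalEquiv upperHalfPlaneSet Δ.carrier) : Prop :=
  Δ.toDobrushinDomain.IsChordalUniformizing φ ∧ ‖φ.symm 0‖ = 1

/-- **Existence of the normalised map** when `0 ∈ D`: take any chordal uniformizing map `φ`
(`MarkedDomain.exists_isChordalUniformizing_holds`, proved from the Riemann mapping theorem and
Carathéodory's theorem) and precompose with the dilation by `c = |φ⁻¹(0)| > 0`, which fixes `0`
and `∞`. [LSW04] §4.2. [cite: LawlerSchrammWerner2004, §4.2] -/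
theorem exists_isLSWMap (h0 : (0 : ℂ) ∈ Δ.carrier) :
    ∃ φ : ConformalEquiv upperHalfPlaneSet Δ.carrier, Δ.IsLSWMap φ := by
  obtain ⟨φ, hφ⟩ := MarkedDomain.exists_isChordalUniformizing_holds Δ.toDobrushinDomain
  have hmem : φ.symm 0 ∈ upperHalfPlaneSet := φ.symm_mapsTo h0
  have hne : φ.symm 0 ≠ 0 := by
    intro h
    have : (0 : ℝ) < (φ.symm 0).im := hmem
    rw [h, Complex.zero_im] at this
    exact lt_irrefl _ this
  set c : ℝ := ‖φ.symm 0‖ with hc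
  have hcpos : 0 < c := norm_pos_iff.2 hne
  refine ⟨(ConformalEquiv.smulUpperHalfPlane c hcpos).trans φ, hφ.smul_trans c hcpos, ?_⟩
  change ‖(ConformalEquiv.smulUpperHalfPlane c hcpos).symm (φ.symm 0)‖ = 1
  rw [ConformalEquiv.smulUpperHalfPlane_symm_apply, norm_smul, norm_inv, Real.norm_eq_abs,
    abs_of_pos hcpos, ← hc, inv_mul_cancel₀ hcpos.ne']

end Domain

/-- **The capacity parametrisation of `φ ∘ γ` and its driving function** ([LSW04] Thm. 4.4:
"let `γ̂ := φ ∘ γ`, parameterized according to capacity from `∞`, and let `W(t)` denote the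
Loewner driving process for `γ̂`"; §2.1, pp. 946–947, for the encoding of simple curves from `0`
to `∞` in `ℍ̄` by the chordal Loewner equation). For a Peano path `γ` of `D` (the polygonal curve
`γ.curve` on `[0, ℓ + 1]`, from `a` to `b` through `D`) and the normalised map (`φ.symm = ` LSW's
`φ : D → ℍ`): `γ̂ : [0, ∞) → ℂ` is obtained from `φ⁻¹ ∘ γ` on the open time interval `(0, ℓ + 1)`
by an increasing continuous time change `θ` from `[0, ℓ + 1)` onto `[0, ∞)` (`θ(0) = 0`,
`θ → ∞`), starts at `γ̂(0) = 0 = φ(a)`, and the chordal Loewner chain driven by the continuous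
`W` is generated by `γ̂` (`Loewner.IsGeneratedByCurve W γ̂`: the hull at time `t` is the complement
of the unbounded component of `ℍ ∖ γ̂[0, t]`; as the hulls of a Loewner chain have half-plane
capacity `2t`, this says precisely that `γ̂` is parametrised by capacity and that `W` is its
driving function). [cite: LawlerSchrammWerner2004, Thm. 4.4] -/
structure IsCapacityImage (Δ : Domain) (φ : ConformalEquiv upperHalfPlaneSet Δ.carrier)
    (γ : PeanoPath Δ) (γhat : C(ℝ≥0, ℂ)) (W : C(ℝ≥0, ℝ)) : Prop where
  /-- `γ̂` is an increasing reparametrisation onto `[0, ∞)` of `φ⁻¹ ∘ γ` on `(0, ℓ + 1)` -/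
  exists_timeChange : ∃ θ : ℝ → ℝ≥0, ContinuousOn θ (Ico 0 γ.tlen) ∧ StrictMonoOn θ (Ico 0 γ.tlen) ∧
    θ 0 = 0 ∧ Tendsto θ (𝓝[<] (γ.tlen : ℝ)) atTop ∧
    ∀ s ∈ Ioo (0 : ℝ) γ.tlen, γhat (θ s) = φ.symm (γ.curve s)
  /-- `γ̂` starts at `φ(a) = 0` -/
  apply_zero : γhat 0 = 0
  /-- the Loewner chain of `W` is generated by `γ̂` (capacity parametrisation, driving function) -/
  isGeneratedByCurve : Loewner.IsGeneratedByCurve W γhat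

/-! ### §4.3: smooth domains and their grid approximations -/

/-- **The domains of [LSW04] §4.3** (p. 977: "Let `D ⊊ ℂ` be a simply connected domain containing
`0`, whose boundary is a `C¹`-simple closed path. Let `a` and `b` be two distinct points on
`∂D`"): a Jordan domain with two marked boundary points `a = pt 0`, `b = pt 1` (the tree's
`MarkedDomain 2`, whose boundary loop is part of the data), containing `0`, whose boundary loop is
continuously differentiable with nonvanishing derivative (a `C¹` regular parametrisation) and
positively oriented (the inner normal `i · γ'` points into `D`; this fixes which complementary arc
is clockwise). [cite: LawlerSchrammWerner2004, §4.3] -/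
structure SmoothDomain where
  /-- the Jordan domain with the marked points `a = pt 0`, `b = pt 1` -/
  toMarkedDomain : MarkedDomain 2
  /-- `0 ∈ D` -/
  zero_mem : (0 : ℂ) ∈ toMarkedDomain.carrier
  /-- the boundary loop is `C¹` -/
  contDiff_boundary : ContDiff ℝ 1 toMarkedDomain.boundary
  /-- the boundary loop is regular -/
  deriv_boundary_ne_zero : ∀ t, deriv toMarkedDomain.boundary t ≠ 0
  /-- the boundary loop is positively oriented: `D` lies to its left -/
  ccw : ∀ t : ℝ, ∀ᶠ s : ℝ in nhdsWithin 0 (Ioi 0),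
    toMarkedDomain.boundary t + (s : ℂ) * (Complex.I * deriv toMarkedDomain.boundary t) ∈
      toMarkedDomain.carrier

namespace SmoothDomain

variable (D : SmoothDomain)

/-- The arc `α_D` traversed from `a` to `b`: "`α_D` [is] the clockwise arc of `∂D` from `b` to
`a`" ([LSW04] p. 977); with the positively oriented boundary loop it is the loop run forward from
the parameter of `a` to that of `b`, here as a curve on `[0, 1]` from `a` to `b` (the direction
in which the wired lattice path `α = [α_a, …, α_b]` is listed). [cite: LawlerSchrammWerner2004, §4.3] -/
def arcA : Curve ℂ :=
  ⟨⟨fun t : I ↦ D.toMarkedDomain.boundary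
      (D.toMarkedDomain.mark 0 + (t : ℝ) * (D.toMarkedDomain.mark 1 - D.toMarkedDomain.mark 0)),
    D.toMarkedDomain.continuous_boundary.comp (by fun_prop)⟩⟩

/-- The arc `β_D` traversed from `a` to `b`: "`β_D` [is] the anticlockwise arc of `∂D` from `b`
to `a`" ([LSW04] p. 977), i.e. the loop run backward from the parameter of `a` (`+1`) to that of
`b`, as a curve on `[0, 1]` from `a` to `b`. [cite: LawlerSchrammWerner2004, §4.3] -/
def arcB : Curve ℂ :=
  ⟨⟨fun t : I ↦ D.toMarkedDomain.boundary
      (D.toMarkedDomain.mark 0 + 1 -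
        (t : ℝ) * (D.toMarkedDomain.mark 0 + 1 - D.toMarkedDomain.mark 1)),
    D.toMarkedDomain.continuous_boundary.comp (by fun_prop)⟩⟩

/-- Value of `arcA`. [folklore] -/
theorem arcA_apply (t : I) : D.arcA t = D.toMarkedDomain.boundary
    (D.toMarkedDomain.mark 0 + (t : ℝ) * (D.toMarkedDomain.mark 1 - D.toMarkedDomain.mark 0)) :=
  rfl

/-- Value of `arcB`. [folklore] -/
theorem arcB_apply (t : I) : D.arcB t = D.toMarkedDomain.boundary
    (D.toMarkedDomain.mark 0 + 1 -
      (t : ℝ) * (D.toMarkedDomain.mark 0 + 1 - D.toMarkedDomain.mark 1)) :=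
  rfl

/-- `α_D` runs from `a` … [folklore] -/
@[simp] theorem arcA_zero : D.arcA 0 = D.toMarkedDomain.pt 0 := by
  simp [arcA_apply, MarkedDomain.pt]

/-- … to `b`. [folklore] -/
@[simp] theorem arcA_one : D.arcA 1 = D.toMarkedDomain.pt 1 := by
  simp [arcA_apply, MarkedDomain.pt]

/-- `β_D` runs from `a` … [folklore] -/
@[simp] theorem arcB_zero : D.arcB 0 = D.toMarkedDomain.pt 0 := by
  simp [arcB_apply, MarkedDomain.pt, D.toMarkedDomain.periodic_boundary (D.toMarkedDomain.mark 0)]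

/-- … to `b`. [folklore] -/
@[simp] theorem arcB_one : D.arcB 1 = D.toMarkedDomain.pt 1 := by
  simp [arcB_apply, MarkedDomain.pt]

end SmoothDomain

namespace SmoothDomain

/-- The boundary loop of the unit disc has derivative `2πi e^{2πit}`. [folklore] -/
theorem hasDerivAt_unitDisc_boundary (t : ℝ) :
    HasDerivAt (fun t : ℝ ↦ circleMap 0 1 (2 * π * t))
      (circleMap 0 1 (2 * π * t) * Complex.I * (2 * π)) t := by
  have h1 : HasDerivAt (fun t : ℝ ↦ 2 * π * t) (2 * π) t := by
    simpa using (hasDerivAt_id t).const_mul (2 * π)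
  have h2 := (hasDerivAt_circleMap 0 1 (2 * π * t)).scomp t h1
  have h3 : HasDerivAt (fun t : ℝ ↦ circleMap 0 1 (2 * π * t))
      ((2 * π) • (circleMap 0 1 (2 * π * t) * Complex.I)) t := h2
  convert h3 using 1
  rw [Complex.real_smul]
  push_cast
  ring

/-- **The unit disc with `a = 1`, `b = -1`** as a smooth domain: boundary `t ↦ e^{2πit}` (`C¹`,
regular, positively oriented: `e^{2πit} + s · i · (2πi e^{2πit}) = (1 - 2πs) e^{2πit}` lies in the
disc for `0 < s < 1/π`), `α_D` = the upper half circle, `β_D` = the lower one. Non-vacuity witness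
for `SmoothDomain` (and the domain intended for `hasSLETrace_eight`). [folklore] -/
def unitDisc : SmoothDomain where
  toMarkedDomain := DobrushinDomain.unitDisc
  zero_mem := by simp [DobrushinDomain.unitDisc]
  contDiff_boundary := by
    change ContDiff ℝ 1 fun t : ℝ ↦ circleMap 0 1 (2 * π * t)
    exact (contDiff_circleMap 0 1).comp (contDiff_const.mul contDiff_id)
  deriv_boundary_ne_zero t := by
    change deriv (fun t : ℝ ↦ circleMap 0 1 (2 * π * t)) t ≠ 0
    rw [(hasDerivAt_unitDisc_boundary t).deriv]
    simp [circleMap, Complex.exp_ne_zero, Real.pi_ne_zero, Complex.I_ne_zero]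
  ccw t := by
    change ∀ᶠ s : ℝ in nhdsWithin 0 (Ioi 0), circleMap 0 1 (2 * π * t) +
      (s : ℂ) * (Complex.I * deriv (fun t : ℝ ↦ circleMap 0 1 (2 * π * t)) t) ∈
        Metric.ball (0 : ℂ) 1
    rw [(hasDerivAt_unitDisc_boundary t).deriv]
    have hmem : Ioo (0 : ℝ) (1 / π) ∈ nhdsWithin (0 : ℝ) (Ioi 0) := Ioo_mem_nhdsGT (by positivity)
    filter_upwards [hmem] with s hs
    have key : circleMap 0 1 (2 * π * t) +
        (s : ℂ) * (Complex.I * (circleMap 0 1 (2 * π * t) * Complex.I * (2 * π))) =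
        ((1 - 2 * π * s : ℝ) : ℂ) * circleMap 0 1 (2 * π * t) := by
      push_cast
      ring_nf
      rw [Complex.I_sq]
      ring
    rw [key, Metric.mem_ball, dist_zero_right, norm_mul, Complex.norm_real, Real.norm_eq_abs]
    have hc : ‖circleMap 0 1 (2 * π * t)‖ = 1 := by
      rw [circleMap, zero_add, Complex.ofReal_one, one_mul, Complex.norm_exp_ofReal_mul_I]
    rw [hc, mul_one, abs_lt]
    have h2 : 2 * π * s < 2 := by
      have := hs.2
      rw [lt_div_iff₀ pi_pos] at this
      linarith
    constructor <;> nlinarith [hs.1, pi_pos]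

/-- The marked points of the unit disc are `a = 1` … [folklore] -/
@[simp] theorem unitDisc_pt_zero : unitDisc.toMarkedDomain.pt 0 = 1 := by
  change circleMap 0 1 (2 * π * 0) = 1
  simp [circleMap]

/-- … and `b = -1`. [folklore] -/
@[simp] theorem unitDisc_pt_one : unitDisc.toMarkedDomain.pt 1 = -1 := by
  change circleMap 0 1 (2 * π * (1 / 2 : ℝ)) = -1
  rw [show 2 * π * (1 / 2 : ℝ) = π by ring]
  simp [circleMap, Complex.exp_pi_mul_I]

end SmoothDomain

/-- A curve scaled by the real factor `R` (`RD`, `Rα_D`, `Rβ_D` in [LSW04] §4.3). [folklore] -/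
def scaleCurve (R : ℝ) (c : Curve ℂ) : Curve ℂ :=
  ⟨⟨fun t ↦ (R : ℂ) * c t, continuous_const.mul c.continuous⟩⟩

/-- Value of a scaled curve. [folklore] -/
@[simp] theorem scaleCurve_apply (R : ℝ) (c : Curve ℂ) (t : I) : scaleCurve R c t = R * c t := rfl

/-- A lattice path (list of points) as a curve on `[0, 1]`, traversed at uniform speed per edge
(for the distance `ρ` of [LSW04] §3.4 only the trace up to reparametrisation matters).
[folklore] -/
def pathCurve (pts : List ℂ) : Curve ℂ :=
  ⟨⟨fun t : I ↦ affineInterp pts (((pts.length : ℝ) - 1) * t),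
    (continuous_affineInterp pts).comp (by fun_prop)⟩⟩

/-- Value of `pathCurve`. [folklore] -/
theorem pathCurve_apply (pts : List ℂ) (t : I) :
    pathCurve pts t = affineInterp pts (((pts.length : ℝ) - 1) * t) := rfl

/-- A path curve starts at the first point. [folklore] -/
@[simp] theorem pathCurve_zero (p : ℂ) (pts : List ℂ) : pathCurve (p :: pts) 0 = p := by
  simp [pathCurve_apply]

/-- **Grid approximations** `D^R = D(α^R, β^R, a^R, b^R) ∈ 𝔇*` of `(RD, Rα_D, Rβ_D)` ([LSW04] §4.3,
p. 977): "Fix some sufficiently large constant `C > 0`; for example, `C = 10` would do. We require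
`α^R` to be a simple path in `ℤ²` satisfying `ρ(α^R, Rα_D) ≤ C` and require `β^R` to be a simple
path in the dual grid satisfying `ρ(β^R, Rβ_D) ≤ C`. We also require that `β^R ∩ α^R = ∅`, of
course, and that each of `a^R, b^R` is a Peano vertex adjacent to an endpoint of `α^R` and an
endpoint of `β^R`." Here `ρ` is the reparametrisation distance of paths (§3.4, p. 953; the tree's
`Curve.reparamDist`), `C = 10`, simplicity / disjointness / adjacency are part of
`USTPeano.Domain`, and we add `0 ∈ D^R` (LSW normalise `φ_R` by `|φ_R(0)| = 1`, p. 977).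
[cite: LawlerSchrammWerner2004, §4.3] -/
def IsApproximation (D : SmoothDomain) (R : ℝ) (Δ : Domain) : Prop :=
  Curve.reparamDist (pathCurve (Δ.α.map primalPt)) (scaleCurve R D.arcA) ≤ 10 ∧
    Curve.reparamDist (pathCurve (Δ.β.map dualPt)) (scaleCurve R D.arcB) ≤ 10 ∧
      (0 : ℂ) ∈ Δ.carrier

/-- The path `t ↦ B(8t)` of the canonical Brownian motion as an element of `C([0, ∞), ℝ)` (the
limit "law of `B(8t)`" of [LSW04] Thm. 4.4 / p. 981, `B` standard Brownian motion).
[cite: LawlerSchrammWerner2004, Thm. 4.4] -/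
def brownianTimeEight (ω : ℝ≥0 → ℝ) : C(ℝ≥0, ℝ) :=
  ⟨fun t ↦ Process.brownian (8 * t) ω,
    (Process.continuous_brownian ω).comp (continuous_const.mul continuous_id)⟩

/-- Value of `brownianTimeEight`. [folklore] -/
@[simp] theorem brownianTimeEight_apply (ω : ℝ≥0 → ℝ) (t : ℝ≥0) :
    brownianTimeEight ω t = Process.brownian (8 * t) ω := rfl

/-- `ω ↦ B(8·)(ω)` is a random element of path space. [folklore] -/
theorem measurable_brownianTimeEight : Measurable brownianTimeEight :=
  Process.measurable_continuousMap_of_eval fun t ↦ Process.measurable_brownian (8 * t)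

end USTPeano

end Literature.Probability.RandomPlanarGeometry
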